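import Literature.Topology.FourManifolds.NonSeparatingSpheresCover
import Literature.Topology.FourManifolds.EmbeddedSubmanifoldDualCircle
import HarnessLib

/-!
# Budney–Gabai Thm. 3.13: a normal arc to a non-separating sphere, lifted from the cyclic cover

Companion to `NonSeparatingSpheresCover.lean` (the cyclic cover `π = exp × id : ℝ × Sⁿ → S¹ × Sⁿ`
and the lift `ẽ` of an embedded `n`-sphere `e`) and `EmbeddedSubmanifoldDualCircle.lean` (normal
arcs inside prescribed neighbourhoods, closing arcs to embedded circles), for the fact seat of
`Literature.Topology.FourManifolds.BudneyGabai2019_thm_3_13` (R. Budney, D. Gabai, *Knotted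
3-balls in `S⁴`*, arXiv:1912.09029, Thm. 3.13, proof p. 22: the dual circle of a non-separating
sphere).  For the degree count of the dual circle it is convenient to choose its germ at the
crossing point **in the cover**: this file constructs a normal arc `γ̃ : ℝ → ℝ × Sⁿ` to the
lifted sphere `ẽ(Sⁿ)` at `ẽ x₀`, short enough to lie in one sheet of the covering and to miss
all the other lifts `τₘ ẽ(Sⁿ)`, `m ≠ 0`, and shows that its projection `γ = π ∘ γ̃` is a normal
arc to `e(Sⁿ)` at `e x₀` in `S¹ × Sⁿ` (injective immersion, meeting `e(Sⁿ)` only at `0`,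
transversally), ready to be closed up to the dual circle
(`BudneyGabai2019_thm_3_13.exists_coverNormalArc`).  On the way:
`injective_mfderiv_prodMap_circleExp` — the covering map `exp × id` is an immersion (it has
smooth local sections `(z, p) ↦ (A z, p)`, `A` an angle function).

Everything here is proved; no definition and no named fact is introduced.

## References

* R. Budney, D. Gabai, *Knotted 3-balls in `S⁴`*, arXiv:1912.09029 (v2), §3, proof of Thm. 3.13
  (p. 22). [BudneyGabai2019]
* A. Hatcher, *Algebraic Topology*, CUP (2002), §1.3 (covering spaces, local sections).
  [HatcherAT2002]
-/

noncomputable section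

open scoped Manifold ContDiff Topology Real
open Set Function Metric Module Filter

namespace Literature.Topology.FourManifolds

namespace BudneyGabai2019_thm_3_13

variable {n : ℕ}

/-- A real function with values in `2πℤ + const`... (general form): a real function whose values
are integer multiples of `2π`, continuous at a point, is constant near that point. [folklore] -/
private theorem eventually_eq_of_continuousAt_of_int_mul {α : Type*} [TopologicalSpace α]
    {f : α → ℝ} {x₀ : α} (hf : ContinuousAt f x₀) (hZ : ∀ x, ∃ k : ℤ, f x = k * (2 * π)) :
    ∀ᶠ x in 𝓝 x₀, f x = f x₀ := by
  have hπ : (0 : ℝ) < 2 * π := by positivity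
  have h := (Metric.tendsto_nhds.1 hf) (2 * π) hπ
  filter_upwards [h] with x hx
  obtain ⟨k, hk⟩ := hZ x
  obtain ⟨k₀, hk₀⟩ := hZ x₀
  rw [hk, hk₀] at hx ⊢
  rw [Real.dist_eq, ← sub_mul, abs_mul, abs_of_pos hπ] at hx
  have h1 : |((k : ℝ) - k₀)| < 1 := by
    by_contra h2
    push Not at h2
    have : (1 : ℝ) * (2 * π) ≤ |(k : ℝ) - k₀| * (2 * π) := mul_le_mul_of_nonneg_right h2 hπ.le
    linarith
  have h3 : |k - k₀| < 1 := by exact_mod_cast h1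
  rw [eq_of_sub_eq_zero (Int.abs_lt_one_iff.1 h3)]

/-- **The covering map `exp × id : ℝ × Sⁿ → S¹ × Sⁿ` is an immersion**: its differential is
injective everywhere.  It has a smooth local section `(z, p) ↦ (A z, p)` through every point,
`A` an angle function of the circle smooth at `e^{it}` (`CircleExpLift.exists_angle_contMDiffAt`),
whose composite with `exp × id` is, near the point, the translation `(s, p) ↦ (s + c, p)`.
[folklore] -/
theorem injective_mfderiv_prodMap_circleExp
    (q : ℝ × Metric.sphere (0 : EuclideanSpace ℝ (Fin (n + 1))) 1) :
    Injective (mfderiv (𝓘(ℝ, ℝ).prod (𝓡 n)) ((𝓡 1).prod (𝓡 n))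
      (Prod.map Circle.exp id : ℝ × Metric.sphere (0 : EuclideanSpace ℝ (Fin (n + 1))) 1 →
        Circle × Metric.sphere (0 : EuclideanSpace ℝ (Fin (n + 1))) 1) q) := by
  obtain ⟨A, hA, hAexp⟩ := CircleExpLift.exists_angle_contMDiffAt (Circle.exp q.1)
  set P := (Prod.map Circle.exp id : ℝ × Metric.sphere (0 : EuclideanSpace ℝ (Fin (n + 1))) 1 →
        Circle × Metric.sphere (0 : EuclideanSpace ℝ (Fin (n + 1))) 1) with hP
  set σ : Circle × Metric.sphere (0 : EuclideanSpace ℝ (Fin (n + 1))) 1 →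
      ℝ × Metric.sphere (0 : EuclideanSpace ℝ (Fin (n + 1))) 1 := fun z ↦ (A z.1, z.2) with hσ
  have hσs : ContMDiffAt ((𝓡 1).prod (𝓡 n)) (𝓘(ℝ, ℝ).prod (𝓡 n)) ∞ σ (P q) :=
    (hA.comp (P q) contMDiffAt_fst).prodMk contMDiffAt_snd
  -- `σ ∘ P` is a translation near `q`
  set c₀ : ℝ := A (Circle.exp q.1) - q.1 with hc₀
  have hZ : ∀ t : ℝ, ∃ k : ℤ, (A (Circle.exp t) - t) = k * (2 * π) := fun t ↦ by
    obtain ⟨m, hm⟩ := Circle.exp_eq_exp.1 (hAexp (Circle.exp t))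
    exact ⟨m, by linarith⟩
  have hcont : ContinuousAt (fun t : ℝ ↦ A (Circle.exp t) - t) q.1 := by
    have h1 : ContinuousAt A (Circle.exp q.1) := hA.continuousAt
    exact (h1.comp (Circle.exp.continuous.continuousAt)).sub continuousAt_id
  have hev1 : ∀ᶠ t in 𝓝 q.1, A (Circle.exp t) - t = c₀ :=
    eventually_eq_of_continuousAt_of_int_mul hcont hZ
  set sh : ℝ × Metric.sphere (0 : EuclideanSpace ℝ (Fin (n + 1))) 1 →
      ℝ × Metric.sphere (0 : EuclideanSpace ℝ (Fin (n + 1))) 1 :=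
    fun r ↦ ((r.1 + c₀, r.2) : ℝ × Metric.sphere (0 : EuclideanSpace ℝ (Fin (n + 1))) 1) with hshdef
  set sh' : ℝ × Metric.sphere (0 : EuclideanSpace ℝ (Fin (n + 1))) 1 →
      ℝ × Metric.sphere (0 : EuclideanSpace ℝ (Fin (n + 1))) 1 :=
    fun r ↦ ((r.1 - c₀, r.2) : ℝ × Metric.sphere (0 : EuclideanSpace ℝ (Fin (n + 1))) 1) with hsh'def
  have hev : σ ∘ P =ᶠ[𝓝 q] sh := by
    have : ∀ᶠ r in 𝓝 q, A (Circle.exp r.1) - r.1 = c₀ := continuousAt_fst.eventually hev1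
    filter_upwards [this] with r hr
    refine Prod.ext ?_ ?_
    · simp only [comp_apply, hσ, hP, hshdef, Prod.map_fst]
      linarith
    · simp only [comp_apply, hσ, hP, hshdef, Prod.map_snd, id_eq]
  -- the translation is a diffeomorphism: its differential is injective
  have hshs : ContMDiff (𝓘(ℝ, ℝ).prod (𝓡 n)) (𝓘(ℝ, ℝ).prod (𝓡 n)) ∞ sh :=
    (contMDiff_fst.add contMDiff_const).prodMk contMDiff_snd
  have hsh's : ContMDiff (𝓘(ℝ, ℝ).prod (𝓡 n)) (𝓘(ℝ, ℝ).prod (𝓡 n)) ∞ sh' :=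
    (contMDiff_fst.sub contMDiff_const).prodMk contMDiff_snd
  have hshcomp : sh' ∘ sh = id := funext fun r ↦ Prod.ext (by simp [hshdef, hsh'def]) rfl
  have hinj_sh : Injective (mfderiv (𝓘(ℝ, ℝ).prod (𝓡 n)) (𝓘(ℝ, ℝ).prod (𝓡 n)) sh q) := by
    have h1 : mfderiv (𝓘(ℝ, ℝ).prod (𝓡 n)) (𝓘(ℝ, ℝ).prod (𝓡 n)) (sh' ∘ sh) q =
        (mfderiv (𝓘(ℝ, ℝ).prod (𝓡 n)) (𝓘(ℝ, ℝ).prod (𝓡 n)) sh' (sh q)).comp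
          (mfderiv (𝓘(ℝ, ℝ).prod (𝓡 n)) (𝓘(ℝ, ℝ).prod (𝓡 n)) sh q) :=
      mfderiv_comp q (hsh's.mdifferentiableAt (by simp)) (hshs.mdifferentiableAt (by simp))
    have h2 : mfderiv (𝓘(ℝ, ℝ).prod (𝓡 n)) (𝓘(ℝ, ℝ).prod (𝓡 n)) (sh' ∘ sh) q =
        ContinuousLinearMap.id ℝ (TangentSpace (𝓘(ℝ, ℝ).prod (𝓡 n)) q) := by
      rw [hshcomp, mfderiv_id]
    have h3 : Injective (mfderiv (𝓘(ℝ, ℝ).prod (𝓡 n)) (𝓘(ℝ, ℝ).prod (𝓡 n)) (sh' ∘ sh) q) := by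
      rw [h2]
      exact injective_id
    rw [h1] at h3
    have key : Injective (⇑(mfderiv (𝓘(ℝ, ℝ).prod (𝓡 n)) (𝓘(ℝ, ℝ).prod (𝓡 n)) sh' (sh q)) ∘
        ⇑(mfderiv (𝓘(ℝ, ℝ).prod (𝓡 n)) (𝓘(ℝ, ℝ).prod (𝓡 n)) sh q)) := h3
    exact key.of_comp
  -- chain rule
  have hchain : mfderiv (𝓘(ℝ, ℝ).prod (𝓡 n)) (𝓘(ℝ, ℝ).prod (𝓡 n)) (σ ∘ P) q =
      (mfderiv ((𝓡 1).prod (𝓡 n)) (𝓘(ℝ, ℝ).prod (𝓡 n)) σ (P q)).comp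
        (mfderiv (𝓘(ℝ, ℝ).prod (𝓡 n)) ((𝓡 1).prod (𝓡 n)) P q) :=
    mfderiv_comp q (hσs.mdifferentiableAt (by simp))
      (contMDiff_prodMap_circleExp.mdifferentiableAt (by simp))
  rw [← hev.mfderiv_eq, hchain] at hinj_sh
  have key : Injective (⇑(mfderiv ((𝓡 1).prod (𝓡 n)) (𝓘(ℝ, ℝ).prod (𝓡 n)) σ (P q)) ∘
      ⇑(mfderiv (𝓘(ℝ, ℝ).prod (𝓡 n)) ((𝓡 1).prod (𝓡 n)) P q)) := hinj_sh
  exact key.of_comp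

/-- **A normal arc to a non-separating sphere, lifted from the cyclic cover.**  Let
`e : Sⁿ → S¹ × Sⁿ`, `n ≥ 2`, be a smooth embedding and `x₀ ∈ Sⁿ`.  There are a lift
`ẽ : Sⁿ → ℝ × Sⁿ` of `e` (a smooth embedding with `(exp × id) ∘ ẽ = e`) and a `C^∞` arc
`γ̃ : ℝ → ℝ × Sⁿ` with `γ̃ 0 = ẽ x₀`, meeting `ẽ(Sⁿ)` only at `0`, transversally
(`dγ̃₀(1) ∉ dẽ_{x₀}(T Sⁿ)`), and missing every other lift `τₘ ẽ(Sⁿ)`, `m ≠ 0`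
(`τₘ (t, p) = (t + 2πm, p)`), whose projection `γ = (exp × id) ∘ γ̃` is a `C^∞` injective
immersion of `ℝ` into `S¹ × Sⁿ` with `γ 0 = e x₀`, meeting `e(Sⁿ)` only at `0`, transversally
(`dγ₀(1) ∉ de_{x₀}(T Sⁿ)`).  (The arc is a normal arc of `exists_normalArc_subset` inside a
neighbourhood of `ẽ x₀` contained in one sheet of the covering and disjoint from the finitely
many other lifts that approach it.) [cite: BudneyGabai2019, proof of Thm. 3.13 (arXiv:1912.09029 v2, p. 22)] -/
theorem exists_coverNormalArc (hn : 2 ≤ n)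
    {e : Metric.sphere (0 : EuclideanSpace ℝ (Fin (n + 1))) 1 →
      Circle × Metric.sphere (0 : EuclideanSpace ℝ (Fin (n + 1))) 1}
    (he : Manifold.IsSmoothEmbedding (𝓡 n) ((𝓡 1).prod (𝓡 n)) ∞ e)
    (x₀ : Metric.sphere (0 : EuclideanSpace ℝ (Fin (n + 1))) 1) :
    ∃ el : Metric.sphere (0 : EuclideanSpace ℝ (Fin (n + 1))) 1 →
        ℝ × Metric.sphere (0 : EuclideanSpace ℝ (Fin (n + 1))) 1,
      Manifold.IsSmoothEmbedding (𝓡 n) (𝓘(ℝ, ℝ).prod (𝓡 n)) ∞ el ∧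
      Prod.map Circle.exp id ∘ el = e ∧
      ∃ γt : ℝ → ℝ × Metric.sphere (0 : EuclideanSpace ℝ (Fin (n + 1))) 1,
        ContMDiff 𝓘(ℝ, ℝ) (𝓘(ℝ, ℝ).prod (𝓡 n)) ∞ γt ∧ γt 0 = el x₀ ∧
        (∀ s, s ≠ 0 → γt s ∉ range el) ∧
        (mfderiv 𝓘(ℝ, ℝ) (𝓘(ℝ, ℝ).prod (𝓡 n)) γt 0 (1 : ℝ) : ℝ × EuclideanSpace ℝ (Fin n)) ∉
          (mfderiv (𝓡 n) (𝓘(ℝ, ℝ).prod (𝓡 n)) el x₀).range ∧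
        (∀ (s : ℝ) (m : ℤ), m ≠ 0 → ∀ x, γt s ≠ ((el x).1 + m * (2 * π), (el x).2)) ∧
        ContMDiff 𝓘(ℝ, ℝ) ((𝓡 1).prod (𝓡 n)) ∞ (Prod.map Circle.exp id ∘ γt) ∧
        Injective (Prod.map Circle.exp id ∘ γt) ∧
        (∀ s, Injective (mfderiv 𝓘(ℝ, ℝ) ((𝓡 1).prod (𝓡 n)) (Prod.map Circle.exp id ∘ γt) s)) ∧
        (Prod.map Circle.exp id ∘ γt) 0 = e x₀ ∧
        (∀ s, s ≠ 0 → (Prod.map Circle.exp id ∘ γt) s ∉ range e) ∧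
        (mfderiv 𝓘(ℝ, ℝ) ((𝓡 1).prod (𝓡 n)) (Prod.map Circle.exp id ∘ γt) 0 (1 : ℝ) :
            EuclideanSpace ℝ (Fin 1) × EuclideanSpace ℝ (Fin n)) ∉
          (mfderiv (𝓡 n) ((𝓡 1).prod (𝓡 n)) e x₀).range := by
  set P := (Prod.map Circle.exp id : ℝ × Metric.sphere (0 : EuclideanSpace ℝ (Fin (n + 1))) 1 →
        Circle × Metric.sphere (0 : EuclideanSpace ℝ (Fin (n + 1))) 1) with hP
  have hPs : ContMDiff (𝓘(ℝ, ℝ).prod (𝓡 n)) ((𝓡 1).prod (𝓡 n)) ∞ P := contMDiff_prodMap_circleExp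
  -- ### the lift of the sphere
  obtain ⟨el, hel, hlift⟩ := exists_lift_isSmoothEmbedding hn he
  have heinj : Injective e := he.isEmbedding.injective
  have helc : Continuous el := hel.contMDiff.continuous
  set t₀ : ℝ := (el x₀).1 with ht₀
  -- ### the finitely many other lifts near `ẽ x₀` and the sheet `W`
  -- `t`-bound of the lifted sphere
  obtain ⟨R, hR⟩ : ∃ R : ℝ, ∀ x, |(el x).1| ≤ R := by
    obtain ⟨R, hR⟩ := (isCompact_range (continuous_fst.comp helc)).isBounded.subset_closedBall 0
    exact ⟨R, fun x ↦ by simpa [Real.dist_eq] using hR ⟨x, rfl⟩⟩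
  have hR0 : 0 ≤ R := le_trans (abs_nonneg _) (hR x₀)
  -- translates with `|m| > M` stay at `t`-distance `≥ 1` from `t₀`
  obtain ⟨M, hM⟩ : ∃ M : ℕ, ∀ m : ℤ, (M : ℤ) < |m| → ∀ x, 1 ≤ |(el x).1 + m * (2 * π) - t₀| := by
    refine ⟨Nat.ceil ((2 * R + 1) / (2 * π)), fun m hm x ↦ ?_⟩
    have hπ : (0 : ℝ) < 2 * π := by positivity
    have h1 : (2 * R + 1) / (2 * π) ≤ (Nat.ceil ((2 * R + 1) / (2 * π)) : ℝ) := Nat.le_ceil _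
    have h2 : ((Nat.ceil ((2 * R + 1) / (2 * π)) : ℤ) : ℝ) + 1 ≤ (|m| : ℤ) := by
      exact_mod_cast hm
    have h3 : (2 * R + 1) / (2 * π) + 1 ≤ |(m : ℝ)| := by
      have : ((|m| : ℤ) : ℝ) = |(m : ℝ)| := by push_cast; rfl
      rw [← this]
      push_cast at h2
      linarith
    have h4 : 2 * R + 1 ≤ |(m : ℝ)| * (2 * π) := by
      have := (div_le_iff₀ hπ).1 (by linarith : (2 * R + 1) / (2 * π) ≤ |(m : ℝ)|)
      linarith
    have h5 : |(m : ℝ) * (2 * π)| = |(m : ℝ)| * (2 * π) := by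
      rw [abs_mul, abs_of_pos hπ]
    -- `|a + b - c| ≥ |b| - |a| - |c|`
    have h6 := abs_sub_abs_le_abs_sub ((m : ℝ) * (2 * π)) (t₀ - (el x).1)
    have h7 : |t₀ - (el x).1| ≤ R + R := (abs_sub _ _).trans (add_le_add (hR x₀) (hR x))
    have h8 : |(m : ℝ) * (2 * π) - (t₀ - (el x).1)| = |(el x).1 + m * (2 * π) - t₀| := by
      congr 1; ring
    rw [h8, h5] at h6
    linarith
  -- the bad set: translates by `0 < |m| ≤ M`
  set S : Finset ℤ := ((Finset.Icc (-(M : ℤ)) M).erase 0) with hS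
  set τ : ℤ → ℝ × Metric.sphere (0 : EuclideanSpace ℝ (Fin (n + 1))) 1 →
      ℝ × Metric.sphere (0 : EuclideanSpace ℝ (Fin (n + 1))) 1 :=
    fun m q ↦ ((q.1 + m * (2 * π), q.2) : ℝ × Metric.sphere (0 : EuclideanSpace ℝ (Fin (n + 1))) 1)
    with hτ
  have hτc : ∀ m, Continuous (τ m) := fun m ↦
    (continuous_fst.add continuous_const).prodMk continuous_snd
  set BAD : Set (ℝ × Metric.sphere (0 : EuclideanSpace ℝ (Fin (n + 1))) 1) :=
    ⋃ m ∈ S, τ m '' range el with hBAD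
  have hBADc : IsClosed BAD := by
    refine (Set.Finite.isClosed_biUnion S.finite_toSet fun m _ ↦ ?_)
    exact ((isCompact_range helc).image (hτc m)).isClosed
  have hq₀BAD : el x₀ ∉ BAD := by
    intro h
    simp only [hBAD, mem_iUnion] at h
    obtain ⟨m, hmS, hm⟩ := h
    have hm0 : m ≠ 0 := (Finset.mem_erase.1 hmS).1
    exact (disjoint_range_lift_deck heinj hlift hm0).le_bot ⟨⟨x₀, rfl⟩, hm⟩
  set W : Set (ℝ × Metric.sphere (0 : EuclideanSpace ℝ (Fin (n + 1))) 1) :=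
    {q | |q.1 - t₀| < 1} ∩ BADᶜ with hW
  have hWopen : IsOpen W :=
    (isOpen_lt (continuous_abs.comp (continuous_fst.sub continuous_const)) continuous_const).inter
      hBADc.isOpen_compl
  have hq₀W : el x₀ ∈ W := ⟨by simp [ht₀], hq₀BAD⟩
  -- points of `W` are not on any other lift
  have hWmiss : ∀ q ∈ W, ∀ m : ℤ, m ≠ 0 → ∀ x, q ≠ τ m (el x) := by
    intro q hq m hm x hqx
    by_cases hmM : (M : ℤ) < |m|
    · have h1 := hM m hmM x
      have h2 : |q.1 - t₀| < 1 := hq.1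
      rw [hqx] at h2
      exact absurd h1 (not_le.2 h2)
    · apply hq.2
      simp only [hBAD, mem_iUnion]
      refine ⟨m, ?_, ⟨el x, ⟨x, rfl⟩, hqx.symm⟩⟩
      rw [hS, Finset.mem_erase, Finset.mem_Icc]
      push Not at hmM
      exact ⟨hm, abs_le.1 hmM⟩
  -- `P` is injective on the slab `|t - t₀| < 1`
  have hPinj : ∀ q q' : ℝ × Metric.sphere (0 : EuclideanSpace ℝ (Fin (n + 1))) 1,
      |q.1 - t₀| < 1 → |q'.1 - t₀| < 1 → P q = P q' → q = q' := by
    intro q q' hq hq' hPq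
    obtain ⟨m, hm⟩ := (prodMap_circleExp_eq_iff q q').1 hPq
    have hm1 : |(m : ℝ) * (2 * π)| < 2 := by
      have : (m : ℝ) * (2 * π) = (q.1 - t₀) - (q'.1 - t₀) := by rw [hm]; ring
      rw [this]
      exact (abs_sub _ _).trans_lt (by linarith)
    have hm0 : m = 0 := by
      by_contra h0
      have h1 : (1 : ℝ) ≤ |(m : ℝ)| := by exact_mod_cast Int.one_le_abs h0
      rw [abs_mul, abs_of_pos (by positivity : (0 : ℝ) < 2 * π)] at hm1
      nlinarith [Real.pi_gt_three]
    rw [hm, hm0]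
    simp
  -- ### the normal arc in the sheet
  have hdim : finrank ℝ (EuclideanSpace ℝ (Fin n)) < finrank ℝ (ℝ × EuclideanSpace ℝ (Fin n)) := by
    rw [finrank_prod, Module.finrank_self, finrank_euclideanSpace_fin]
    omega
  obtain ⟨γt, hγs, hγinj, hγimm, hγ0, hγoff, hγtr, hγW⟩ :=
    exists_normalArc_subset hel hdim x₀ (hWopen.mem_nhds hq₀W)
  have hγmiss : ∀ (s : ℝ) (m : ℤ), m ≠ 0 → ∀ x, γt s ≠ ((el x).1 + m * (2 * π), (el x).2) :=
    fun s m hm x ↦ hWmiss _ (hγW s) m hm x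
  -- ### the projected arc
  set γ := P ∘ γt with hγ
  have hγPs : ContMDiff 𝓘(ℝ, ℝ) ((𝓡 1).prod (𝓡 n)) ∞ γ := hPs.comp hγs
  have hγPinj : Injective γ := fun s s' h ↦ hγinj (hPinj _ _ (hγW s).1 (hγW s').1 h)
  have hγPimm : ∀ s, Injective (mfderiv 𝓘(ℝ, ℝ) ((𝓡 1).prod (𝓡 n)) γ s) := fun s ↦ by
    rw [hγ, mfderiv_comp s (hPs.mdifferentiableAt (by simp)) ((hγs s).mdifferentiableAt (by simp))]
    have key : Injective (⇑(mfderiv (𝓘(ℝ, ℝ).prod (𝓡 n)) ((𝓡 1).prod (𝓡 n)) P (γt s)) ∘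
        ⇑(mfderiv 𝓘(ℝ, ℝ) (𝓘(ℝ, ℝ).prod (𝓡 n)) γt s)) :=
      (injective_mfderiv_prodMap_circleExp _).comp (hγimm s)
    exact key
  have hγP0 : γ 0 = e x₀ := by
    rw [hγ, comp_apply, hγ0, ← hlift]
    rfl
  have hγPoff : ∀ s, s ≠ 0 → γ s ∉ range e := by
    intro s hs ⟨x, hx⟩
    rw [← hlift, comp_apply, hγ, comp_apply] at hx
    obtain ⟨m, hm⟩ := (prodMap_circleExp_eq_iff (γt s) (el x)).1 hx.symm
    by_cases hm0 : m = 0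
    · rw [hm0] at hm
      simp only [Int.cast_zero, zero_mul, add_zero, Prod.mk.eta] at hm
      exact hγoff s hs ⟨x, hm.symm⟩
    · exact hγmiss s m hm0 x hm
  refine ⟨el, hel, hlift, γt, hγs, hγ0, hγoff, hγtr, hγmiss, hγPs, hγPinj, hγPimm, hγP0, hγPoff, ?_⟩
  -- ### transversality downstairs
  rintro ⟨ξ, hξ⟩
  have hξ' : mfderiv (𝓡 n) ((𝓡 1).prod (𝓡 n)) e x₀ ξ =
      mfderiv 𝓘(ℝ, ℝ) ((𝓡 1).prod (𝓡 n)) γ 0 (1 : ℝ) := hξ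
  apply hγtr
  -- `de = dP ∘ dẽ` and `dγ = dP ∘ dγ̃`
  have hDe : mfderiv (𝓡 n) ((𝓡 1).prod (𝓡 n)) e x₀ =
      (mfderiv (𝓘(ℝ, ℝ).prod (𝓡 n)) ((𝓡 1).prod (𝓡 n)) P (el x₀)).comp
        (mfderiv (𝓡 n) (𝓘(ℝ, ℝ).prod (𝓡 n)) el x₀) := by
    rw [← hlift]
    exact mfderiv_comp x₀ (hPs.mdifferentiableAt (by simp)) (hel.contMDiff.mdifferentiableAt (by simp))
  have hDγ : mfderiv 𝓘(ℝ, ℝ) ((𝓡 1).prod (𝓡 n)) γ 0 =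
      (mfderiv (𝓘(ℝ, ℝ).prod (𝓡 n)) ((𝓡 1).prod (𝓡 n)) P (γt 0)).comp
        (mfderiv 𝓘(ℝ, ℝ) (𝓘(ℝ, ℝ).prod (𝓡 n)) γt 0) :=
    mfderiv_comp 0 (hPs.mdifferentiableAt (by simp)) ((hγs 0).mdifferentiableAt (by simp))
  have h1 : (mfderiv (𝓘(ℝ, ℝ).prod (𝓡 n)) ((𝓡 1).prod (𝓡 n)) P (el x₀))
      (mfderiv (𝓡 n) (𝓘(ℝ, ℝ).prod (𝓡 n)) el x₀ ξ) =
      (mfderiv (𝓘(ℝ, ℝ).prod (𝓡 n)) ((𝓡 1).prod (𝓡 n)) P (γt 0))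
        (mfderiv 𝓘(ℝ, ℝ) (𝓘(ℝ, ℝ).prod (𝓡 n)) γt 0 (1 : ℝ)) := by
    have h2 := congrArg (fun T : TangentSpace (𝓡 n) x₀ →L[ℝ]
      TangentSpace ((𝓡 1).prod (𝓡 n)) (e x₀) ↦ T ξ) hDe
    have h3 := congrArg (fun T : TangentSpace 𝓘(ℝ, ℝ) (0 : ℝ) →L[ℝ]
      TangentSpace ((𝓡 1).prod (𝓡 n)) (γ 0) ↦ T 1) hDγ
    have h2' : mfderiv (𝓡 n) ((𝓡 1).prod (𝓡 n)) e x₀ ξ =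
        (mfderiv (𝓘(ℝ, ℝ).prod (𝓡 n)) ((𝓡 1).prod (𝓡 n)) P (el x₀))
          (mfderiv (𝓡 n) (𝓘(ℝ, ℝ).prod (𝓡 n)) el x₀ ξ) := h2
    have h3' : mfderiv 𝓘(ℝ, ℝ) ((𝓡 1).prod (𝓡 n)) γ 0 (1 : ℝ) =
        (mfderiv (𝓘(ℝ, ℝ).prod (𝓡 n)) ((𝓡 1).prod (𝓡 n)) P (γt 0))
          (mfderiv 𝓘(ℝ, ℝ) (𝓘(ℝ, ℝ).prod (𝓡 n)) γt 0 (1 : ℝ)) := h3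
    rw [← h2', ← h3']
    exact hξ'
  -- move the base point `γ̃ 0 = ẽ x₀`
  have hbase : ∀ w : ℝ × EuclideanSpace ℝ (Fin n),
      (mfderiv (𝓘(ℝ, ℝ).prod (𝓡 n)) ((𝓡 1).prod (𝓡 n)) P (γt 0)) w =
        (mfderiv (𝓘(ℝ, ℝ).prod (𝓡 n)) ((𝓡 1).prod (𝓡 n)) P (el x₀)) w := by
    intro w
    rw [hγ0]
  rw [hbase] at h1
  have h4 := injective_mfderiv_prodMap_circleExp (el x₀) h1
  exact ⟨ξ, h4⟩

end BudneyGabai2019_thm_3_13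

end Literature.Topology.FourManifolds

end
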